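import Summits.QuantumFields.YangMills.Theorems.UnitScaleTiltProp7GaugeDirPlaqK
import Summits.QuantumFields.YangMills.Theorems.UnitScaleTiltProp7SliceOfCorrectorRows
import HarnessLib

/-!
# `MinimiserStabilityRegPr` — negative-side support: THE ORBIT TEST for the path-(α)∕(α′) doors of route-R E′
# (no non-trivial small PINNED GAUGE COPY of the background passes the slice row `DIV_W(D) ≤ ζ·K_W(D) + δ₁ℓ⁻²·Σ‖D‖²`)

Support file for crux `stmt-QuantumFields-19200` (`UnitScaleTilt.MinimiserStabilityRegPr`), route-R E′, cell ym3-torus, width seat px15 (gen 2); extracted from the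
LOCATE memo `LOCATE-MASS-JUNCTION-px15g2.md` §6–§7 (ORBIT TEST, 2026-08-28; verdict «CONFIRMED» + «ORBIT-NEG GO» by the route-R E′ namer ★p1 g15, bus 20:35:45Z).
Tree objects only; THEOREMS ONLY (0 `def`, 0 `sorry`); `--supports stmt-QuantumFields-19200`, count-neutral, zero credit.  YM₃ on T³ is a ladder rung (R3), not the Clay
problem; nothing here refutes the crux, the stub or E′ — it refutes ONE RECIPE for inhabiting the E′ doors.

THE POINT.  The doors ✓ `Prop7LocMinOfPinnedChartSlice.stub_PV3E_of_fibrePointSlice` (and, through it, the (α′) knit ✓ `Prop7PV3EOfCorrectorRows.stub_PV3E_of_correctorRows`)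
ask, per competitor `W′` of the R2-critical background `W`, for a fibre point `Y` with the same action whose chart `D_b = (−i)log((Y_bW_b⁻¹))` satisfies the SLICE ROW
`DIV_W(D) ≤ ζ·K_W(D) + δ₁·ℓ⁻²·Σ_b‖D_b‖²` with L-only `ζ ≥ 0` and `δ₁ < 4κ_H = 1∕(32(18 + 537600L⁴))`.  This file proves that the row is violated by every fibre point whose
chart is bondwise second-order close to a non-zero PINNED PURE GAUGE of `W` — in particular (★★★ `gaugeCopy_eq_of_sliceRow`) by every non-trivial small gauge copy `W^{w}`
of `W` itself, once two pinned-Poincaré rows for the gauge parameter (displayed; sharp flat sizes `P₁ ≍ ℓ²∕8 … ℓ³∕4`, `P₀ ≍ ℓ⁴∕69`, cell numerics kit j316909 ∕ px8 #55) and the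
window `16ζa²d²P₀ + (64ζ + 16)·d·h²·P₁ + 8δ₁ℓ⁻²P₁ < 1` hold (at the doors' constants: `≈ ζe² + δ₁ℓ∕2·(ℓ²∕P₁) + O(ζh²ℓ³) < 1` for small amplitude `h`).  CONSEQUENCE
(memo §6 (O-1)∕(O-2), kit j317584∕j317585): an instantiation of the doors must return `Y = W` EXACTLY on the pinned gauge orbit of `W` and, by openness of the failure set, a
representative with NO pinned-gauge residual near it; the (α′) recipe «Thm-2 datum → untwist → ONE linear `S_H` corrector» leaves a second-order residual `W^{exp O(h²)}`
(non-abelian data) and therefore cannot inhabit ✓p659387 — the corrector must be iterated to its fixed point (exact pinned gauge fixing, «(E1)») or the lane merges into the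
EX HESS row («(E2)»).  Nothing landed is mooted: the knit and its suppliers are exactly (E1)'s derivative bound and nonlinearity modulus.

WHAT IS PROVED (ns `…Theorems.Prop7PinnedOrbitSliceRow`; filed flat under `Theorems/` as a HELPER — the `Theorems/<Crux>/Negative/` lane is the refuters' `--negative-modulo` lane and would hold the item, which this lemma does not warrant; carrier = the doors' own: run `K` of a `T3Family`, `SU(2)`, background `W` with plaquette window
`dist1(W(∂p)) ≤ a`).
* §1 (any finite site set with bijective shifts, `SU(n)` transport; then the torus, any `P i`, `SU(N)`) `sum_norm_covDstar_sq_le_four_mul`, `sum_norm_divB_sq_le`,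
  ★ `divB_HS_sq_le_mass` — the crude divergence bound `Σ_xΣ_{jk}‖(D*_{U₀}(i·G))(x)_{jk}‖² ≤ 4dN·Σ_b‖G_b‖²` for ANY bond field.
* §2 ★★ `pinnedGauge_eq_zero_of_sliceRow` — `ω` ANY site field, `Z_b := ω(b₋) − W_b·ω(b₊)·W_b*` its covariant gauge direction (✓ `Prop7GaugeDirPlaqK` letter), `D` ANY bond field
  with `‖D_b − Z_b‖ ≤ h‖Z_b‖` (`h ≤ 1`), Poincaré rows `Σ_x‖ω‖² ≤ P₀·DIV_W(iZ)`, `Σ_b‖Z_b‖² ≤ P₁·DIV_W(iZ)` (displayed), window as above: the slice row for `D` forces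
  `DIV_W(iZ) = 0`, hence `Z = 0` and `D = 0`;  `not_sliceRow_of_ne_zero` — the `¬` form.
* (sequel `…Prop7PinnedOrbitSliceRowGaugeCopy`) ★★★ `gaugeCopy_eq_of_sliceRow` — for a gauge transformation `w` with `‖w(x) − 1‖ ≤ 1∕64`, `3‖log w(x)‖ ≤ h ≤ 1`, the chart
  `D_b = (−i)log↑((W^w)_bW_b⁻¹)` of the GAUGE COPY `W^w` IS second-order close to `Z` with `ω := (−i)log∘w` (✓ `Prop7PinnedRegaugeChartBCH.norm_mlog_twist_sub_pureGauge_le_refined`),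
  so under the same displayed rows the slice row forces `(W^w)_b = W_b` on every bond: the copy IS `W`.
HONEST SCOPE.  Algebra over landed bricks; the Poincaré rows are displayed per `ω` (their flat sharp sizes are cell numerics, not tree theorems — the tree's
✓ `Prop7PointPinnedPoincare`∕✓ `Prop7CentrePinnedHessianPoincare` give the `ℓ³`∕`ℓ⁴` laws with loose constants); constants ours.

References: T. Bałaban, CMP 102 (1985) 277–309 [Balaban1985Variational] ((6) p.278, (47)–(48) pp.285–286, (141)–(143) p.299, Prop. 7 p.299); CMP 99 (1985) 389–434
[Balaban1985BackgroundPropagators] ((3.8)–(3.11) p.392); CMP 98 (1985) 17–51 [Balaban1985Averaging] ((8), (11) p.19, (21) p.21, (31) p.22).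
-/

set_option autoImplicit false

noncomputable section

open scoped BigOperators Matrix.Norms.L2Operator Matrix
open NormedSpace

namespace Summit.QuantumFields.YangMills.Theorems.Prop7PinnedOrbitSliceRow

open Literature.MathematicalPhysics.QuantumFieldTheory.Balaban1983to89
open Literature.MathematicalPhysics.QuantumFieldTheory.Balaban1983to89.T3ContinuumYM3Torus
open Finset B1RG242Torus
open MatrixLog (mlog norm_mlog_le_two_mul)
open B9Eq39Adjoint (R R_def covD covDstar curl divB)
open B10StarCount (sum_pbond)
open B10Eq27TorusAxialLog (unitsField toUField)
open B9TorusCalculus (torusT)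
open Summit.QuantumFields.YangMills.Theorems.Prop7CovariantCoercivity (sum_norm_sq_le_mul_opNorm_sq)
open Summit.QuantumFields.YangMills.Theorems.Prop7PinnedRegaugeChartDivergenceTorus (norm_R_inv_eq coe_unitsField_toUField)
open Summit.QuantumFields.YangMills.Theorems.Prop7PinnedRegaugeChartDivergenceHRK (plaqK_le_sum_bond)
open Summit.QuantumFields.YangMills.Theorems.Prop7GaugeDirPlaqK (plaqK_gaugeDir_le_sites)
open Summit.QuantumFields.YangMills.Theorems.Prop7SliceOfCorrectorRows (K_add_le DIV_add_le)
open Summit.QuantumFields.YangMills.Theorems.Prop7PinnedRegaugeChartBCH (norm_mlog_twist_sub_pureGauge_le_refined)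

/-! ## §1 The crude divergence bound -/

section Abstract

variable {n : Type*} [Fintype n] [DecidableEq n] [Nonempty n]
variable {S : Type*} [Fintype S] {ι : Type*} [Fintype ι] (T : ι → Equiv.Perm S) (U : ι → S → (Matrix n n ℂ)ˣ)
  (W : ι → S → Matrix.specialUnitaryGroup n ℂ)

omit [Fintype ι] in
/-- `Σ_x ‖(D*_μG)(x)‖² ≤ 4·Σ_x ‖G(x)‖²` (`‖D*_μG(x)‖ ≤ ‖G(x − e_μ)‖ + ‖G(x)‖`, isometric transport, re-indexing along the shift).
[folklore] [cite: Balaban1985BackgroundPropagators, (3.8) p.392] -/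
theorem sum_norm_covDstar_sq_le_four_mul (hUW : ∀ μ x, (U μ x : Matrix n n ℂ) = (W μ x : Matrix n n ℂ)) (μ : ι) (G : S → Matrix n n ℂ) :
    ∑ x, ‖covDstar T U μ G x‖ ^ 2 ≤ 4 * ∑ x, ‖G x‖ ^ 2 := by
  have hpt : ∀ x, ‖covDstar T U μ G x‖ ^ 2 ≤ 2 * ‖G ((T μ).symm x)‖ ^ 2 + 2 * ‖G x‖ ^ 2 := by
    intro x
    have h1 : ‖covDstar T U μ G x‖ ≤ ‖G ((T μ).symm x)‖ + ‖G x‖ := by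
      unfold covDstar
      exact (norm_sub_le _ _).trans (by rw [norm_R_inv_eq U W hUW])
    have h0 : 0 ≤ ‖covDstar T U μ G x‖ := norm_nonneg _
    nlinarith [sq_nonneg (‖G ((T μ).symm x)‖ - ‖G x‖), h1, h0, norm_nonneg (G ((T μ).symm x)), norm_nonneg (G x)]
  have hre : ∑ x, ‖G ((T μ).symm x)‖ ^ 2 = ∑ x, ‖G x‖ ^ 2 :=
    Equiv.sum_comp (T μ).symm (fun x => ‖G x‖ ^ 2)
  calc ∑ x, ‖covDstar T U μ G x‖ ^ 2 ≤ ∑ x, (2 * ‖G ((T μ).symm x)‖ ^ 2 + 2 * ‖G x‖ ^ 2) := Finset.sum_le_sum fun x _ => hpt x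
    _ = 4 * ∑ x, ‖G x‖ ^ 2 := by rw [Finset.sum_add_distrib, ← Finset.mul_sum, ← Finset.mul_sum, hre]; ring

/-- **CRUDE DIVERGENCE BOUND (operator norm)**: `Σ_x ‖(D*A)(x)‖² ≤ 4|ι|·Σ_μ Σ_x ‖A_μ(x)‖²`. [folklore] [cite: Balaban1985BackgroundPropagators, (3.8) p.392] -/
theorem sum_norm_divB_sq_le (hUW : ∀ μ x, (U μ x : Matrix n n ℂ) = (W μ x : Matrix n n ℂ)) (A : ι → S → Matrix n n ℂ) :
    ∑ x, ‖divB T U A x‖ ^ 2 ≤ 4 * Fintype.card ι * ∑ μ, ∑ x, ‖A μ x‖ ^ 2 := by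
  have hpt : ∀ x, ‖divB T U A x‖ ^ 2 ≤ Fintype.card ι * ∑ μ, ‖covDstar T U μ (A μ) x‖ ^ 2 := by
    intro x
    have h1 : ‖divB T U A x‖ ≤ ∑ μ, ‖covDstar T U μ (A μ) x‖ := by
      unfold divB; exact norm_sum_le _ _
    calc ‖divB T U A x‖ ^ 2 ≤ (∑ μ, ‖covDstar T U μ (A μ) x‖) ^ 2 := by gcongr
      _ ≤ Fintype.card ι * ∑ μ, ‖covDstar T U μ (A μ) x‖ ^ 2 :=
          Summit.QuantumFields.YangMills.Theorems.Prop7PinnedRegaugeChartDivergence.sq_sum_univ_le_card_mul _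
  calc ∑ x, ‖divB T U A x‖ ^ 2 ≤ ∑ x, (Fintype.card ι * ∑ μ, ‖covDstar T U μ (A μ) x‖ ^ 2) := Finset.sum_le_sum fun x _ => hpt x
    _ = Fintype.card ι * ∑ μ, ∑ x, ‖covDstar T U μ (A μ) x‖ ^ 2 := by rw [← Finset.mul_sum, Finset.sum_comm]
    _ ≤ Fintype.card ι * ∑ μ, (4 * ∑ x, ‖A μ x‖ ^ 2) := by
        gcongr with μ _
        exact sum_norm_covDstar_sq_le_four_mul T U W hUW μ (A μ)
    _ = 4 * Fintype.card ι * ∑ μ, ∑ x, ‖A μ x‖ ^ 2 := by rw [← Finset.mul_sum]; ring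

end Abstract

section Torus

variable {P : Params} {N : ℕ} [NeZero N] {i : ℕ}

/-- ★ **CRUDE DIVERGENCE BOUND IN THE DOORS' LETTERS**: for ANY bond field `G` on the torus and any `SU(N)` background `U₀`,
`Σ_x Σ_{jk} ‖(D*_{U₀}(i·G))(x)_{jk}‖² ≤ 4dN·Σ_b ‖G_b‖²`. [folklore] [cite: Balaban1985BackgroundPropagators, (3.8) p.392] -/
theorem divB_HS_sq_le_mass (U₀ : GaugeField P i (Matrix.specialUnitaryGroup (Fin N) ℂ)) (G : PBond P i → Matrix (Fin N) (Fin N) ℂ) :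
    (∑ x : Site P i, ∑ j : Fin N, ∑ k : Fin N,
        ‖(divB (torusT P i) (fun κ z => unitsField (toUField U₀) ⟨z, κ⟩) (fun κ z => Complex.I • G ⟨z, κ⟩) x) j k‖ ^ 2)
      ≤ 4 * P.d * N * ∑ b : PBond P i, ‖G b‖ ^ 2 := by
  have hUW := coe_unitsField_toUField U₀
  have hN : (0 : ℝ) ≤ N := Nat.cast_nonneg N
  have h1 : ∀ x : Site P i, (∑ j : Fin N, ∑ k : Fin N,
        ‖(divB (torusT P i) (fun κ z => unitsField (toUField U₀) ⟨z, κ⟩) (fun κ z => Complex.I • G ⟨z, κ⟩) x) j k‖ ^ 2)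
      ≤ N * ‖divB (torusT P i) (fun κ z => unitsField (toUField U₀) ⟨z, κ⟩) (fun κ z => Complex.I • G ⟨z, κ⟩) x‖ ^ 2 :=
    fun x => sum_norm_sq_le_mul_opNorm_sq _
  have h2 := sum_norm_divB_sq_le (torusT P i) (fun κ z => unitsField (toUField U₀) ⟨z, κ⟩) (fun κ z => U₀ ⟨z, κ⟩) hUW
    (fun κ z => Complex.I • G ⟨z, κ⟩)
  have hM : ∑ μ : Fin P.d, ∑ x : Site P i, ‖Complex.I • G ⟨x, μ⟩‖ ^ 2 = ∑ b : PBond P i, ‖G b‖ ^ 2 := by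
    rw [sum_pbond, Finset.sum_comm]
    refine Finset.sum_congr rfl fun x _ => Finset.sum_congr rfl fun μ _ => ?_
    rw [norm_smul, Complex.norm_I, one_mul]
  rw [hM, Fintype.card_fin] at h2
  calc (∑ x : Site P i, ∑ j : Fin N, ∑ k : Fin N,
        ‖(divB (torusT P i) (fun κ z => unitsField (toUField U₀) ⟨z, κ⟩) (fun κ z => Complex.I • G ⟨z, κ⟩) x) j k‖ ^ 2)
      ≤ ∑ x : Site P i, N * ‖divB (torusT P i) (fun κ z => unitsField (toUField U₀) ⟨z, κ⟩) (fun κ z => Complex.I • G ⟨z, κ⟩) x‖ ^ 2 :=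
        Finset.sum_le_sum fun x _ => h1 x
    _ = N * ∑ x : Site P i, ‖divB (torusT P i) (fun κ z => unitsField (toUField U₀) ⟨z, κ⟩) (fun κ z => Complex.I • G ⟨z, κ⟩) x‖ ^ 2 := by
        rw [Finset.mul_sum]
    _ ≤ N * (4 * P.d * ∑ b : PBond P i, ‖G b‖ ^ 2) := mul_le_mul_of_nonneg_left h2 hN
    _ = 4 * P.d * N * ∑ b : PBond P i, ‖G b‖ ^ 2 := by ring

end Torus

/-! ## §2 The orbit test: the slice row kills every chart that is second-order close to a pinned pure gauge -/

section OrbitTest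

variable (F : T3Family) {n K : ℕ}

/-- ★★ **THE ORBIT TEST (abstract form).**  `W` any `SU(2)` field on run `K`'s torus with plaquette window `dist1(W(∂p)) ≤ a`; `ω` ANY site field and
`Z_b := ω(b₋) − W_b·ω(b₊)·W_b*` its covariant gauge direction; `D` ANY bond field with `‖D_b − Z_b‖ ≤ h·‖Z_b‖` (`0 ≤ h ≤ 1`); DISPLAYED Poincaré rows for `ω`:
`Σ_x‖ω(x)‖² ≤ P₀·DIV_W(iZ)` and `Σ_b‖Z_b‖² ≤ P₁·DIV_W(iZ)` (`DIV_W` = the doors' HS divergence letter); window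
`16ζa²d²P₀ + 64ζ·d·h²·P₁ + 16·d·h²·P₁ + 8·δ₁ℓ⁻²·P₁ < 1` (`ℓ⁻² := ((F.L)^{K−n})⁻²`).  IF the doors' slice row
`DIV_W(iD) ≤ ζ·K_W(iD) + δ₁·ℓ⁻²·Σ_b‖D_b‖²` holds, THEN `DIV_W(iZ) ≤ 0` — hence (next theorems) `Z = 0` and `D = 0`.
Proof: `DIV(Z) ≤ 2DIV(D) + 2DIV(Z − D)` (✓ `DIV_add_le`), `DIV(Z − D) ≤ 8d·h²Σ‖Z‖²` (§1), `K(D) ≤ 2K(Z) + 2K(D − Z)` (✓ `K_add_le`),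
`K(Z) ≤ 4a²d²Σ‖ω‖²` (✓ `plaqK_gaugeDir_le_sites`), `K(D − Z) ≤ 16d·h²Σ‖Z‖²` (✓ `plaqK_le_sum_bond`), `Σ‖D‖² ≤ 4Σ‖Z‖²`, then the two Poincaré rows.
[cite: Balaban1985Variational, (6) p.278, (47)-(48) pp.285-286, (141)-(143) p.299] [cite: Balaban1985BackgroundPropagators, (3.8)-(3.11) p.392] -/
theorem divHS_pinnedGauge_nonpos_of_sliceRow (W : GaugeField (F.P K) 0 (Matrix.specialUnitaryGroup (Fin 2) ℂ)) {a : ℝ}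
    (hW : ∀ p : Plaq (F.P K) 0, dist1 (GaugeField.plaqHol W p) ≤ a)
    (ω : Site (F.P K) 0 → Matrix (Fin 2) (Fin 2) ℂ) (Z D : PBond (F.P K) 0 → Matrix (Fin 2) (Fin 2) ℂ)
    (hZ : ∀ b : PBond (F.P K) 0, Z b = ω b.src - (W b : Matrix (Fin 2) (Fin 2) ℂ) * ω (b.src.shift b.dir) * star (W b : Matrix (Fin 2) (Fin 2) ℂ))
    {h : ℝ} (hh0 : 0 ≤ h) (hh : h ≤ 1) (hN : ∀ b : PBond (F.P K) 0, ‖D b - Z b‖ ≤ h * ‖Z b‖)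
    {P₀ P₁ : ℝ}
    (hP₀ : ∑ x : Site (F.P K) 0, ‖ω x‖ ^ 2 ≤ P₀ * (∑ x : Site (F.P K) 0, ∑ j : Fin 2, ∑ k : Fin 2,
            ‖(divB (torusT (F.P K) 0) (fun κ z => unitsField (toUField W) ⟨z, κ⟩) (fun κ z => Complex.I • Z ⟨z, κ⟩) x) j k‖ ^ 2))
    (hP₁ : ∑ b : PBond (F.P K) 0, ‖Z b‖ ^ 2 ≤ P₁ * (∑ x : Site (F.P K) 0, ∑ j : Fin 2, ∑ k : Fin 2,
            ‖(divB (torusT (F.P K) 0) (fun κ z => unitsField (toUField W) ⟨z, κ⟩) (fun κ z => Complex.I • Z ⟨z, κ⟩) x) j k‖ ^ 2))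
    {ζ δ₁ : ℝ} (hζ : 0 ≤ ζ) (hδ₁ : 0 ≤ δ₁)
    (hwin : 16 * ζ * a ^ 2 * ((F.P K).d : ℝ) ^ 2 * P₀ + 64 * ζ * (F.P K).d * h ^ 2 * P₁ + 16 * (F.P K).d * h ^ 2 * P₁
        + 8 * δ₁ * (((F.L : ℝ) ^ (K - n)) ^ 2)⁻¹ * P₁ < 1)
    (hrow : (∑ x : Site (F.P K) 0, ∑ j : Fin 2, ∑ k : Fin 2,
            ‖(divB (torusT (F.P K) 0) (fun κ z => unitsField (toUField W) ⟨z, κ⟩) (fun κ z => Complex.I • D ⟨z, κ⟩) x) j k‖ ^ 2)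
          ≤ ζ * (∑ p : Plaq (F.P K) 0, ‖((Complex.I • D ⟨p.src, p.μ⟩) + ((W ⟨p.src, p.μ⟩ : Matrix (Fin 2) (Fin 2) ℂ) * (Complex.I • D ⟨p.src.shift p.μ, p.ν⟩) * star (W ⟨p.src, p.μ⟩ : Matrix (Fin 2) (Fin 2) ℂ))
            - (((W ⟨p.src, p.μ⟩ * W ⟨p.src.shift p.μ, p.ν⟩ * (W ⟨p.src.shift p.ν, p.μ⟩)⁻¹ : Matrix.specialUnitaryGroup (Fin 2) ℂ) : Matrix (Fin 2) (Fin 2) ℂ) * (Complex.I • D ⟨p.src.shift p.ν, p.μ⟩) * star ((W ⟨p.src, p.μ⟩ * W ⟨p.src.shift p.μ, p.ν⟩ * (W ⟨p.src.shift p.ν, p.μ⟩)⁻¹ : Matrix.specialUnitaryGroup (Fin 2) ℂ) : Matrix (Fin 2) (Fin 2) ℂ))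
            - (((GaugeField.plaqHol W p : Matrix.specialUnitaryGroup (Fin 2) ℂ) : Matrix (Fin 2) (Fin 2) ℂ) * (Complex.I • D ⟨p.src, p.ν⟩) * star ((GaugeField.plaqHol W p : Matrix.specialUnitaryGroup (Fin 2) ℂ) : Matrix (Fin 2) (Fin 2) ℂ)))‖ ^ 2)
              + δ₁ * (((F.L : ℝ) ^ (K - n)) ^ 2)⁻¹ * ∑ b : PBond (F.P K) 0, ‖D b‖ ^ 2) :
    (∑ x : Site (F.P K) 0, ∑ j : Fin 2, ∑ k : Fin 2,
        ‖(divB (torusT (F.P K) 0) (fun κ z => unitsField (toUField W) ⟨z, κ⟩) (fun κ z => Complex.I • Z ⟨z, κ⟩) x) j k‖ ^ 2) ≤ 0 := by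
  -- letters
  set DZ : ℝ := ∑ x : Site (F.P K) 0, ∑ j : Fin 2, ∑ k : Fin 2,
        ‖(divB (torusT (F.P K) 0) (fun κ z => unitsField (toUField W) ⟨z, κ⟩) (fun κ z => Complex.I • Z ⟨z, κ⟩) x) j k‖ ^ 2 with hDZ
  set DD : ℝ := ∑ x : Site (F.P K) 0, ∑ j : Fin 2, ∑ k : Fin 2,
        ‖(divB (torusT (F.P K) 0) (fun κ z => unitsField (toUField W) ⟨z, κ⟩) (fun κ z => Complex.I • D ⟨z, κ⟩) x) j k‖ ^ 2 with hDD
  set MZ : ℝ := ∑ b : PBond (F.P K) 0, ‖Z b‖ ^ 2 with hMZ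
  set MD : ℝ := ∑ b : PBond (F.P K) 0, ‖D b‖ ^ 2 with hMD
  set Mω : ℝ := ∑ x : Site (F.P K) 0, ‖ω x‖ ^ 2 with hMω
  set ℓ2i : ℝ := (((F.L : ℝ) ^ (K - n)) ^ 2)⁻¹ with hℓ2i
  have hℓ2i0 : 0 ≤ ℓ2i := by positivity
  -- the differences
  have hN2 : ∑ b : PBond (F.P K) 0, ‖D b - Z b‖ ^ 2 ≤ h ^ 2 * MZ := by
    rw [hMZ, Finset.mul_sum]
    refine Finset.sum_le_sum fun b _ => ?_
    have h0 : 0 ≤ ‖D b - Z b‖ := norm_nonneg _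
    calc ‖D b - Z b‖ ^ 2 ≤ (h * ‖Z b‖) ^ 2 := by gcongr; exact hN b
      _ = h ^ 2 * ‖Z b‖ ^ 2 := by ring
  have hN2' : ∑ b : PBond (F.P K) 0, ‖Z b - D b‖ ^ 2 ≤ h ^ 2 * MZ := by
    refine le_trans (le_of_eq (Finset.sum_congr rfl fun b _ => by rw [norm_sub_rev])) hN2
  -- (1) `DIV(Z) ≤ 2DIV(D) + 2DIV(Z − D)` and `DIV(Z − D) ≤ 8d h² MZ`
  have h1 := DIV_add_le F W Z D (fun b => Z b - D b) (fun b => by abel)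
  have h1' := divB_HS_sq_le_mass W (fun b => Z b - D b)
  -- (2) `K(D) ≤ 2K(Z) + 2K(D − Z)`, `K(Z) ≤ 4a²d²Mω`, `K(D − Z) ≤ 16d·h²MZ`
  have h2 := K_add_le F W D Z (fun b => D b - Z b) (fun b => by abel)
  have h2Z := plaqK_gaugeDir_le_sites W hW ω Z hZ
  have h2N := plaqK_le_sum_bond W (fun b => D b - Z b)
  beta_reduce at h1 h1' h2 h2N
  -- (3) `MD ≤ 2MZ + 2h²MZ ≤ 4MZ`
  have h3 : MD ≤ 4 * MZ := by
    have hpt : ∀ b : PBond (F.P K) 0, ‖D b‖ ^ 2 ≤ 2 * ‖Z b‖ ^ 2 + 2 * ‖D b - Z b‖ ^ 2 := by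
      intro b
      have e : D b = Z b + (D b - Z b) := by abel
      have h1 : ‖D b‖ ≤ ‖Z b‖ + ‖D b - Z b‖ := by
        calc ‖D b‖ = ‖Z b + (D b - Z b)‖ := by rw [← e]
          _ ≤ ‖Z b‖ + ‖D b - Z b‖ := norm_add_le _ _
      have h0 : 0 ≤ ‖D b‖ := norm_nonneg _
      nlinarith only [sq_nonneg (‖Z b‖ - ‖D b - Z b‖), h1, h0, norm_nonneg (Z b), norm_nonneg (D b - Z b)]
    have hs : MD ≤ 2 * MZ + 2 * ∑ b : PBond (F.P K) 0, ‖D b - Z b‖ ^ 2 := by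
      rw [hMD, hMZ, Finset.mul_sum, Finset.mul_sum, ← Finset.sum_add_distrib]
      exact Finset.sum_le_sum fun b _ => hpt b
    have hMZ0 : 0 ≤ MZ := Finset.sum_nonneg fun _ _ => sq_nonneg _
    have hh2 : h ^ 2 ≤ 1 := by nlinarith only [hh0, hh]
    nlinarith only [hs, hN2, hMZ0, hh2]
  -- assemble WITHOUT `linarith` on the big letters: pure `le_trans`∕`add_le_add` bookkeeping down to the scalars `DZ, MZ, Mω`
  have hMZ0 : 0 ≤ MZ := Finset.sum_nonneg fun _ _ => sq_nonneg _
  have hDZ0 : 0 ≤ DZ := Finset.sum_nonneg fun _ _ => Finset.sum_nonneg fun _ _ => Finset.sum_nonneg fun _ _ => sq_nonneg _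
  have hd0 : (0 : ℝ) ≤ (F.P K).d := Nat.cast_nonneg _
  have h20 : (0 : ℝ) ≤ 2 := by norm_num
  -- `K(D − Z) ≤ 16 d h² MZ`
  have hKN : _ ≤ 16 * ((F.P K).d : ℝ) * (h ^ 2 * MZ) :=
    h2N.trans (mul_le_mul_of_nonneg_left hN2 (by positivity : (0 : ℝ) ≤ 16 * ((F.P K).d : ℝ)))
  -- `K(D) ≤ 2·(4a²(d²Mω)) + 2·(16 d h² MZ)`
  have hKD : _ ≤ 2 * (4 * a ^ 2 * (((F.P K).d : ℝ) ^ 2 * Mω)) + 2 * (16 * ((F.P K).d : ℝ) * (h ^ 2 * MZ)) :=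
    h2.trans (add_le_add (mul_le_mul_of_nonneg_left h2Z h20) (mul_le_mul_of_nonneg_left hKN h20))
  -- `DIV(Z − D) ≤ 4 d 2 (h² MZ)`
  have hDN : _ ≤ 4 * ((F.P K).d : ℝ) * ((2 : ℕ) : ℝ) * (h ^ 2 * MZ) :=
    h1'.trans (mul_le_mul_of_nonneg_left hN2' (mul_nonneg (mul_nonneg (by norm_num) hd0) (Nat.cast_nonneg _)))
  -- the row, pushed to scalars: `DD ≤ ζ·(…) + δ₁ℓ2i·(4MZ)`
  have hθ : δ₁ * ℓ2i * MD ≤ δ₁ * ℓ2i * (4 * MZ) := mul_le_mul_of_nonneg_left h3 (mul_nonneg hδ₁ hℓ2i0)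
  have hrow' : DD ≤ ζ * (2 * (4 * a ^ 2 * (((F.P K).d : ℝ) ^ 2 * Mω)) + 2 * (16 * ((F.P K).d : ℝ) * (h ^ 2 * MZ))) + δ₁ * ℓ2i * (4 * MZ) :=
    hrow.trans (add_le_add (mul_le_mul_of_nonneg_left hKD hζ) hθ)
  -- `DZ ≤ 2DD + 2DIV(Z − D)`
  have hDZle : DZ ≤ 2 * (ζ * (2 * (4 * a ^ 2 * (((F.P K).d : ℝ) ^ 2 * Mω)) + 2 * (16 * ((F.P K).d : ℝ) * (h ^ 2 * MZ))) + δ₁ * ℓ2i * (4 * MZ))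
      + 2 * (4 * ((F.P K).d : ℝ) * ((2 : ℕ) : ℝ) * (h ^ 2 * MZ)) :=
    h1.trans (add_le_add (mul_le_mul_of_nonneg_left hrow' h20) (mul_le_mul_of_nonneg_left hDN h20))
  -- scalars only from here
  have hc1 : 0 ≤ 16 * ζ * a ^ 2 * ((F.P K).d : ℝ) ^ 2 :=
    mul_nonneg (mul_nonneg (mul_nonneg (by norm_num) hζ) (sq_nonneg a)) (sq_nonneg _)
  have hc2 : 0 ≤ 64 * ζ * ((F.P K).d : ℝ) * h ^ 2 + 16 * (F.P K).d * h ^ 2 + 8 * δ₁ * ℓ2i :=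
    add_nonneg (add_nonneg (mul_nonneg (mul_nonneg (mul_nonneg (by norm_num) hζ) hd0) (sq_nonneg h))
      (mul_nonneg (mul_nonneg (by norm_num) hd0) (sq_nonneg h))) (mul_nonneg (mul_nonneg (by norm_num) hδ₁) hℓ2i0)
  have e1 := mul_le_mul_of_nonneg_left hP₀ hc1
  have e2 := mul_le_mul_of_nonneg_left hP₁ hc2
  have hS : DZ ≤ (16 * ζ * a ^ 2 * ((F.P K).d : ℝ) ^ 2 * P₀ + 64 * ζ * (F.P K).d * h ^ 2 * P₁ + 16 * (F.P K).d * h ^ 2 * P₁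
        + 8 * δ₁ * ℓ2i * P₁) * DZ := by
    have e3 : 2 * (ζ * (2 * (4 * a ^ 2 * (((F.P K).d : ℝ) ^ 2 * Mω)) + 2 * (16 * ((F.P K).d : ℝ) * (h ^ 2 * MZ))) + δ₁ * ℓ2i * (4 * MZ))
        + 2 * (4 * ((F.P K).d : ℝ) * ((2 : ℕ) : ℝ) * (h ^ 2 * MZ))
        = (16 * ζ * a ^ 2 * ((F.P K).d : ℝ) ^ 2) * Mω + (64 * ζ * ((F.P K).d : ℝ) * h ^ 2 + 16 * (F.P K).d * h ^ 2 + 8 * δ₁ * ℓ2i) * MZ := by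
      push_cast; ring
    have e4 : (16 * ζ * a ^ 2 * ((F.P K).d : ℝ) ^ 2) * (P₀ * DZ) + (64 * ζ * ((F.P K).d : ℝ) * h ^ 2 + 16 * (F.P K).d * h ^ 2 + 8 * δ₁ * ℓ2i) * (P₁ * DZ)
        = (16 * ζ * a ^ 2 * ((F.P K).d : ℝ) ^ 2 * P₀ + 64 * ζ * (F.P K).d * h ^ 2 * P₁ + 16 * (F.P K).d * h ^ 2 * P₁ + 8 * δ₁ * ℓ2i * P₁) * DZ := by
      ring
    calc DZ ≤ _ := hDZle
      _ = (16 * ζ * a ^ 2 * ((F.P K).d : ℝ) ^ 2) * Mω + (64 * ζ * ((F.P K).d : ℝ) * h ^ 2 + 16 * (F.P K).d * h ^ 2 + 8 * δ₁ * ℓ2i) * MZ := e3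
      _ ≤ (16 * ζ * a ^ 2 * ((F.P K).d : ℝ) ^ 2) * (P₀ * DZ) + (64 * ζ * ((F.P K).d : ℝ) * h ^ 2 + 16 * (F.P K).d * h ^ 2 + 8 * δ₁ * ℓ2i) * (P₁ * DZ) :=
          add_le_add e1 e2
      _ = _ := e4
  -- `DZ ≤ S·DZ` with `S < 1` and `DZ ≥ 0` ⇒ `DZ ≤ 0`
  set S : ℝ := 16 * ζ * a ^ 2 * ((F.P K).d : ℝ) ^ 2 * P₀ + 64 * ζ * (F.P K).d * h ^ 2 * P₁ + 16 * (F.P K).d * h ^ 2 * P₁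
        + 8 * δ₁ * ℓ2i * P₁ with hSdef
  have h1S : 0 < 1 - S := by linarith only [hwin]
  have key : DZ * (1 - S) ≤ 0 * (1 - S) := by
    have e : DZ * (1 - S) = DZ - S * DZ := by ring
    rw [e, zero_mul]; linarith only [hS]
  exact le_of_mul_le_mul_right key h1S

/-- ★★ **COROLLARY — the chart and the gauge direction both vanish.**  Under the hypotheses of `divHS_pinnedGauge_nonpos_of_sliceRow`: `Z = 0` and `D = 0` on every bond
(`DIV_W(iZ) ≤ 0 ≤ DIV_W(iZ)`, then `Σ‖Z‖² ≤ P₁·0`, then `‖D_b‖ ≤ h·0`).  Read contrapositively: NO chart that is second-order close to a NON-ZERO pinned pure gauge passes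
the slice row. [cite: Balaban1985Variational, (141)-(143) p.299, Prop. 7 p.299] -/
theorem pinnedGauge_eq_zero_of_sliceRow (W : GaugeField (F.P K) 0 (Matrix.specialUnitaryGroup (Fin 2) ℂ)) {a : ℝ}
    (hW : ∀ p : Plaq (F.P K) 0, dist1 (GaugeField.plaqHol W p) ≤ a)
    (ω : Site (F.P K) 0 → Matrix (Fin 2) (Fin 2) ℂ) (Z D : PBond (F.P K) 0 → Matrix (Fin 2) (Fin 2) ℂ)
    (hZ : ∀ b : PBond (F.P K) 0, Z b = ω b.src - (W b : Matrix (Fin 2) (Fin 2) ℂ) * ω (b.src.shift b.dir) * star (W b : Matrix (Fin 2) (Fin 2) ℂ))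
    {h : ℝ} (hh0 : 0 ≤ h) (hh : h ≤ 1) (hN : ∀ b : PBond (F.P K) 0, ‖D b - Z b‖ ≤ h * ‖Z b‖)
    {P₀ P₁ : ℝ}
    (hP₀ : ∑ x : Site (F.P K) 0, ‖ω x‖ ^ 2 ≤ P₀ * (∑ x : Site (F.P K) 0, ∑ j : Fin 2, ∑ k : Fin 2,
            ‖(divB (torusT (F.P K) 0) (fun κ z => unitsField (toUField W) ⟨z, κ⟩) (fun κ z => Complex.I • Z ⟨z, κ⟩) x) j k‖ ^ 2))
    (hP₁ : ∑ b : PBond (F.P K) 0, ‖Z b‖ ^ 2 ≤ P₁ * (∑ x : Site (F.P K) 0, ∑ j : Fin 2, ∑ k : Fin 2,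
            ‖(divB (torusT (F.P K) 0) (fun κ z => unitsField (toUField W) ⟨z, κ⟩) (fun κ z => Complex.I • Z ⟨z, κ⟩) x) j k‖ ^ 2))
    {ζ δ₁ : ℝ} (hζ : 0 ≤ ζ) (hδ₁ : 0 ≤ δ₁)
    (hwin : 16 * ζ * a ^ 2 * ((F.P K).d : ℝ) ^ 2 * P₀ + 64 * ζ * (F.P K).d * h ^ 2 * P₁ + 16 * (F.P K).d * h ^ 2 * P₁
        + 8 * δ₁ * (((F.L : ℝ) ^ (K - n)) ^ 2)⁻¹ * P₁ < 1)
    (hrow : (∑ x : Site (F.P K) 0, ∑ j : Fin 2, ∑ k : Fin 2,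
            ‖(divB (torusT (F.P K) 0) (fun κ z => unitsField (toUField W) ⟨z, κ⟩) (fun κ z => Complex.I • D ⟨z, κ⟩) x) j k‖ ^ 2)
          ≤ ζ * (∑ p : Plaq (F.P K) 0, ‖((Complex.I • D ⟨p.src, p.μ⟩) + ((W ⟨p.src, p.μ⟩ : Matrix (Fin 2) (Fin 2) ℂ) * (Complex.I • D ⟨p.src.shift p.μ, p.ν⟩) * star (W ⟨p.src, p.μ⟩ : Matrix (Fin 2) (Fin 2) ℂ))
            - (((W ⟨p.src, p.μ⟩ * W ⟨p.src.shift p.μ, p.ν⟩ * (W ⟨p.src.shift p.ν, p.μ⟩)⁻¹ : Matrix.specialUnitaryGroup (Fin 2) ℂ) : Matrix (Fin 2) (Fin 2) ℂ) * (Complex.I • D ⟨p.src.shift p.ν, p.μ⟩) * star ((W ⟨p.src, p.μ⟩ * W ⟨p.src.shift p.μ, p.ν⟩ * (W ⟨p.src.shift p.ν, p.μ⟩)⁻¹ : Matrix.specialUnitaryGroup (Fin 2) ℂ) : Matrix (Fin 2) (Fin 2) ℂ))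
            - (((GaugeField.plaqHol W p : Matrix.specialUnitaryGroup (Fin 2) ℂ) : Matrix (Fin 2) (Fin 2) ℂ) * (Complex.I • D ⟨p.src, p.ν⟩) * star ((GaugeField.plaqHol W p : Matrix.specialUnitaryGroup (Fin 2) ℂ) : Matrix (Fin 2) (Fin 2) ℂ)))‖ ^ 2)
              + δ₁ * (((F.L : ℝ) ^ (K - n)) ^ 2)⁻¹ * ∑ b : PBond (F.P K) 0, ‖D b‖ ^ 2) :
    (∀ b : PBond (F.P K) 0, Z b = 0) ∧ (∀ b : PBond (F.P K) 0, D b = 0) := by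
  have hDZ := divHS_pinnedGauge_nonpos_of_sliceRow F W hW ω Z D hZ hh0 hh hN hP₀ hP₁ hζ hδ₁ hwin hrow
  have hDZ0 : 0 ≤ (∑ x : Site (F.P K) 0, ∑ j : Fin 2, ∑ k : Fin 2,
        ‖(divB (torusT (F.P K) 0) (fun κ z => unitsField (toUField W) ⟨z, κ⟩) (fun κ z => Complex.I • Z ⟨z, κ⟩) x) j k‖ ^ 2) :=
    Finset.sum_nonneg fun _ _ => Finset.sum_nonneg fun _ _ => Finset.sum_nonneg fun _ _ => sq_nonneg _
  have hDZeq := le_antisymm hDZ hDZ0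
  rw [hDZeq, mul_zero] at hP₁
  have hZ0 : ∀ b : PBond (F.P K) 0, Z b = 0 := by
    intro b
    have hle : ‖Z b‖ ^ 2 ≤ 0 :=
      (Finset.single_le_sum (f := fun b : PBond (F.P K) 0 => ‖Z b‖ ^ 2) (fun _ _ => sq_nonneg _) (Finset.mem_univ b)).trans hP₁
    have h0 : ‖Z b‖ = 0 := by nlinarith only [hle, norm_nonneg (Z b)]
    exact norm_eq_zero.mp h0
  refine ⟨hZ0, fun b => ?_⟩
  have h := hN b
  rw [hZ0 b, sub_zero, norm_zero, mul_zero] at h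
  exact norm_eq_zero.mp (le_antisymm h (norm_nonneg _))

/-- The `¬` form: a chart `D ≠ 0` that is second-order close to a pinned pure gauge (with the displayed Poincaré rows and window) VIOLATES the slice row.
[cite: Balaban1985Variational, (141)-(143) p.299] -/
theorem not_sliceRow_of_ne_zero (W : GaugeField (F.P K) 0 (Matrix.specialUnitaryGroup (Fin 2) ℂ)) {a : ℝ}
    (hW : ∀ p : Plaq (F.P K) 0, dist1 (GaugeField.plaqHol W p) ≤ a)
    (ω : Site (F.P K) 0 → Matrix (Fin 2) (Fin 2) ℂ) (Z D : PBond (F.P K) 0 → Matrix (Fin 2) (Fin 2) ℂ)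
    (hZ : ∀ b : PBond (F.P K) 0, Z b = ω b.src - (W b : Matrix (Fin 2) (Fin 2) ℂ) * ω (b.src.shift b.dir) * star (W b : Matrix (Fin 2) (Fin 2) ℂ))
    {h : ℝ} (hh0 : 0 ≤ h) (hh : h ≤ 1) (hN : ∀ b : PBond (F.P K) 0, ‖D b - Z b‖ ≤ h * ‖Z b‖)
    {P₀ P₁ : ℝ}
    (hP₀ : ∑ x : Site (F.P K) 0, ‖ω x‖ ^ 2 ≤ P₀ * (∑ x : Site (F.P K) 0, ∑ j : Fin 2, ∑ k : Fin 2,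
            ‖(divB (torusT (F.P K) 0) (fun κ z => unitsField (toUField W) ⟨z, κ⟩) (fun κ z => Complex.I • Z ⟨z, κ⟩) x) j k‖ ^ 2))
    (hP₁ : ∑ b : PBond (F.P K) 0, ‖Z b‖ ^ 2 ≤ P₁ * (∑ x : Site (F.P K) 0, ∑ j : Fin 2, ∑ k : Fin 2,
            ‖(divB (torusT (F.P K) 0) (fun κ z => unitsField (toUField W) ⟨z, κ⟩) (fun κ z => Complex.I • Z ⟨z, κ⟩) x) j k‖ ^ 2))
    {ζ δ₁ : ℝ} (hζ : 0 ≤ ζ) (hδ₁ : 0 ≤ δ₁)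
    (hwin : 16 * ζ * a ^ 2 * ((F.P K).d : ℝ) ^ 2 * P₀ + 64 * ζ * (F.P K).d * h ^ 2 * P₁ + 16 * (F.P K).d * h ^ 2 * P₁
        + 8 * δ₁ * (((F.L : ℝ) ^ (K - n)) ^ 2)⁻¹ * P₁ < 1)
    (hD0 : ∃ b : PBond (F.P K) 0, D b ≠ 0) :
    ¬ ((∑ x : Site (F.P K) 0, ∑ j : Fin 2, ∑ k : Fin 2,
            ‖(divB (torusT (F.P K) 0) (fun κ z => unitsField (toUField W) ⟨z, κ⟩) (fun κ z => Complex.I • D ⟨z, κ⟩) x) j k‖ ^ 2)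
          ≤ ζ * (∑ p : Plaq (F.P K) 0, ‖((Complex.I • D ⟨p.src, p.μ⟩) + ((W ⟨p.src, p.μ⟩ : Matrix (Fin 2) (Fin 2) ℂ) * (Complex.I • D ⟨p.src.shift p.μ, p.ν⟩) * star (W ⟨p.src, p.μ⟩ : Matrix (Fin 2) (Fin 2) ℂ))
            - (((W ⟨p.src, p.μ⟩ * W ⟨p.src.shift p.μ, p.ν⟩ * (W ⟨p.src.shift p.ν, p.μ⟩)⁻¹ : Matrix.specialUnitaryGroup (Fin 2) ℂ) : Matrix (Fin 2) (Fin 2) ℂ) * (Complex.I • D ⟨p.src.shift p.ν, p.μ⟩) * star ((W ⟨p.src, p.μ⟩ * W ⟨p.src.shift p.μ, p.ν⟩ * (W ⟨p.src.shift p.ν, p.μ⟩)⁻¹ : Matrix.specialUnitaryGroup (Fin 2) ℂ) : Matrix (Fin 2) (Fin 2) ℂ))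
            - (((GaugeField.plaqHol W p : Matrix.specialUnitaryGroup (Fin 2) ℂ) : Matrix (Fin 2) (Fin 2) ℂ) * (Complex.I • D ⟨p.src, p.ν⟩) * star ((GaugeField.plaqHol W p : Matrix.specialUnitaryGroup (Fin 2) ℂ) : Matrix (Fin 2) (Fin 2) ℂ)))‖ ^ 2)
              + δ₁ * (((F.L : ℝ) ^ (K - n)) ^ 2)⁻¹ * ∑ b : PBond (F.P K) 0, ‖D b‖ ^ 2) := by
  intro hrow
  obtain ⟨b, hb⟩ := hD0
  exact hb ((pinnedGauge_eq_zero_of_sliceRow F W hW ω Z D hZ hh0 hh hN hP₀ hP₁ hζ hδ₁ hwin hrow).2 b)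

end OrbitTest

end Summit.QuantumFields.YangMills.Theorems.Prop7PinnedOrbitSliceRow

end
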